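import Summits.QuantumAdvantage.QuantumAdvantage.Theorems.WalkThreeStepFarReadFinal

/-!
# Rung (G♯₂) `ThreeStepFreeRungFive` (item stmt-QuantumAdvantage-23286), architecture (U), the FAR-READ LEMMA 6/6 (part b):
# `farRead_isConst` and `farReadHyp'`

Cell qa-qnc0, route OddPrimeWalk, support item stmt-QuantumAdvantage-23286; prover qn-prover-3 g17.

§1 **THE FAR-READ LEMMA** (`farRead_isConst`): if position `π` is register-symmetric with room `64` on both sides and every observer
of `π` sits in `(90, n − 90)`, then every cut at distance `≥ 128` from `π` reading `π` with non-zero total coefficient is CONSTANT.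
Proof: otherwise the far non-constant effective readers of `π` form a non-empty finite set; its topmost member above `π` (if any) or
else its bottommost member below `π` is extremal, giving a `Scene` with `UpMax`/`DownMin` — impossible by file 6/6 part a.
§2 `FarReadHyp'` — the far-read hypothesis of the assembly in the form this proof supplies: like `FarReadHyp` of
`WalkThreeStepAssemblyOfFarRead` (register symmetry on the `W`-neighbourhood; re-representation with `NearReads`) plus the harmless
extra hypothesis that the observers of the neighbourhood sit in `(Z, n − Z)` (the assembly already discards the reads of end-positioned
cuts) — and its proof `farReadHyp'` with `R = 128, W = 64, Z = 90`, via `normalize` (constant cuts re-encoded with zero coefficients).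
WHAT THIS IS NOT: the re-derived assembly and the item are in `OddPrimeWalkThreeStepFreeRungFive`; separation NOT moved.
-/

namespace Summit.QuantumAdvantage.AdviceFreeQNC0.LocalEngine

open Finset Classical

namespace RungU

variable {n : ℕ}

/-! ### §1 The far-read lemma -/

/-- **THE FAR-READ LEMMA.**  A register-symmetric position with room, whose observers sit away from the ends, is read effectively from
distance `≥ 128` only by constant cuts. -/
theorem farRead_isConst (S : ThreeStep 5 n) (π : ℕ) (hsym : ∀ y : Fin n → Bool, reg S (cornerFlip n π y) = reg S y)
    (hroom : 64 ≤ π ∧ π + 64 ≤ n) (hobs : ∀ q : Fin (n + 1), Observes S q π → 90 < q.val ∧ q.val + 90 < n)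
    (g : Fin (n + 1)) (hg : cf S g π ≠ 0) (hfar : π + 128 ≤ g.val ∨ g.val + 128 ≤ π) : IsConst S g := by
  by_contra hnc
  -- the far non-constant effective readers of π
  set F : Finset (Fin (n + 1)) :=
    univ.filter fun q => cf S q π ≠ 0 ∧ (π + 128 ≤ q.val ∨ q.val + 128 ≤ π) ∧ ¬ IsConst S q with hF
  have memF : ∀ q, q ∈ F ↔ (cf S q π ≠ 0 ∧ (π + 128 ≤ q.val ∨ q.val + 128 ≤ π) ∧ ¬ IsConst S q) := by
    intro q; rw [hF, Finset.mem_filter]; simp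
  have hgF : g ∈ F := (memF g).mpr ⟨hg, hfar, hnc⟩
  by_cases hup : ((F.filter fun q => π < q.val)).Nonempty
  · -- the topmost far reader above π
    obtain ⟨hq, hqm, hmax⟩ := Finset.exists_max_image (F.filter fun q => π < q.val) (fun q => q.val) hup
    rw [Finset.mem_filter, memF] at hqm
    obtain ⟨⟨c1, c2, c3⟩, c4⟩ := hqm
    have hupq : π + 128 ≤ hq.val := by omega
    let sc : Scene n :=
      { S := S, π := π, h := hq.val, hq := hq, hq_val := rfl, sym := hsym, reads := c1, nonconst := c3, room := hroom,
        obsPos := hobs, far := Or.inl hupq }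
    refine sc.false_up hupq ?_
    intro q hlt hcq
    change hq.val < q.val at hlt
    by_contra hq'
    have hqF : q ∈ F.filter fun q => π < q.val := by
      rw [Finset.mem_filter, memF]
      exact ⟨⟨hcq, Or.inl (by omega), hq'⟩, by omega⟩
    have := hmax q hqF
    omega
  · -- no far reader above π: the bottommost one below
    rw [Finset.not_nonempty_iff_eq_empty] at hup
    have hFne : F.Nonempty := ⟨g, hgF⟩
    obtain ⟨hq, hqm, hmin⟩ := Finset.exists_min_image F (fun q => q.val) hFne
    have hbelow : ∀ q ∈ F, q.val + 128 ≤ π := by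
      intro q hq
      have hq' : q ∉ F.filter fun q => π < q.val := by rw [hup]; simp
      rw [Finset.mem_filter] at hq'
      have := (memF q).mp hq
      push Not at hq'
      have := hq' hq
      omega
    obtain ⟨c1, c2, c3⟩ := (memF hq).mp hqm
    have hdn : hq.val + 128 ≤ π := hbelow hq hqm
    let sc : Scene n :=
      { S := S, π := π, h := hq.val, hq := hq, hq_val := rfl, sym := hsym, reads := c1, nonconst := c3, room := hroom,
        obsPos := hobs, far := Or.inr hdn }
    refine sc.false_down hdn ?_
    intro q hlt hcq
    change q.val < hq.val at hlt
    by_contra hq'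
    have hqF : q ∈ F := by
      rw [memF]
      exact ⟨hcq, Or.inr (by omega), hq'⟩
    have := hmin q hqF
    omega

/-! ### §2 The far-read hypothesis of the assembly, with observer positions -/

/-- **THE FAR-READ HYPOTHESIS (positioned form)**: on a `W`-neighbourhood of `[a, a+L)` where every position is register-symmetric and
observed only by cuts positioned in `(Z, n − Z)`, the strategy can be re-represented with the same selection functions so that every
effective read landing strictly inside `(a, a+L)` is within `R` of its cut. -/
def FarReadHyp' : Prop :=
  ∃ R W Z : ℕ, ∀ (n : ℕ) (S : ThreeStep 5 n) (a L : ℕ), W + 1 ≤ a → a + L + W ≤ n →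
    (∀ k : ℕ, a ≤ k + W → k < a + L + W →
      (∀ x : Fin n → Bool, reg S (cornerFlip n k x) = reg S x) ∧
      (∀ g : Fin (n + 1), Observes S g k → Z < g.val ∧ g.val + Z < n)) →
    ∃ S' : ThreeStep 5 n, S'.y = S.y ∧ NearReads S' R a L

/-- **PROOF OF THE FAR-READ HYPOTHESIS** (`R = 128`, `W = 64`, `Z = 90`): normalise the constant cuts; a non-constant cut with an
effective read inside the interval at distance `≥ 128` contradicts `farRead_isConst`. -/
theorem farReadHyp' : FarReadHyp' := by
  refine ⟨128, 64, 90, ?_⟩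
  intro n S a L ha hn hyp
  refine ⟨normalize S, normalize_y (by norm_num) S, ?_⟩
  apply nearReads_normalize_of
  intro g hg
  constructor
  · intro hc h1 h2
    have hk := hyp (S.s g) (by omega) (by omega)
    by_contra hfar
    exact hg (farRead_isConst S (S.s g) hk.1 ⟨by omega, by omega⟩ hk.2 g (cf_s_ne_zero S g hc) (by omega))
  · intro hc h1 h2
    have hk := hyp (max (S.s g) (S.t g)) (by omega) (by omega)
    by_contra hfar
    exact hg (farRead_isConst S _ hk.1 ⟨by omega, by omega⟩ hk.2 g (cf_m_ne_zero S g hc) (by omega))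

end RungU

end Summit.QuantumAdvantage.AdviceFreeQNC0.LocalEngine
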